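import Summits.BirchSwinnertonDyer.BirchSwinnertonDyer.Theorems.EisensteinPrimesSelmerAcQuotientCorankLeCurveLocalLambda
import Summits.BirchSwinnertonDyer.BirchSwinnertonDyer.Theorems.EisensteinPrimesSqrtGammaNonsplitFrobenius
import HarnessLib

/-!
# The `f`-side `≤`-half of `rem142_goodLattice_selmerAc_imprimitive` AT ITS VERBATIM BINDERS,
# with no side condition: `corank_{ℤ_p}(Sel_v̄^{Sf}/Sel_v̄) ≤ Σ_{w∈Sf} λ(𝒫_w(f))` for `E ×_ℚ K`

Cell `bsd-eis` (home `run/shared/lean/pub/bsd-eis/`), seat `bsd-line-x1-p1-w2` (D-0154 width seat on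
crux 2 `GoodLatticeBDPValue` = stmt-BirchSwinnertonDyer-19032, line `halves`; host RULINGS L110 (1) /
L112 (2): the registered kernel stub `stub_fSideCorankLe` of the LEAD successor's v16 re-cut = the
binders of `rem142_goodLattice_selmerAc_imprimitive` VERBATIM with conclusion `≤`; signature agreed on
STATUS l.2590).  The final sum p616613 (`SelmerAcQuotientCorankLeCurveLocalLambda`) carried one side
condition `h2` («`E` not non-split multiplicative at `2`») because its non-split case went through
`c₄, c₆ ∈ ℤ` and Euler's criterion at an odd `ℓ`; p617025 (`SqrtGammaNonsplitFrobenius`) makes the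
non-split per-place bound `K_w`-intrinsic and unconditional at every place (inertia fixes `√γ` by the
tree's `TateCurve.toAlgEquiv_eq_of_mem_inertia_of_sq_eq_gamma`; every Frobenius moves it, else `γ` is a
square in `K_w` and the place is split).  Here the final sum is re-run with the multiplicative places
split on `E_K`'s OWN type at `w` (split: p613424; non-split: p617025), which removes `h2`:

* `zpCorank_selmerAc_quotient_le_sum_curveLocalLambda` — the `h2`-free final sum (same statement as
  p616613's, `h2` deleted);
* `stub_fSideCorankLe` — the same at rem142's binders VERBATIM (`Good W p` gives `p ∤ N_E` by
  `dvd_conductorNorm_iff_not_hasGoodReductionAtPrime`; `Red`, `Anom`, the rational-line clause, (Heeg)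
  for `p`, `E(K)[p] = 0`, `ι`, `v`, the two module hypotheses are carried unused): the type of
  `stub_fSideCorankLe`.

HONEST FRAMING: tool theorems (no definition, no named fact introduced or assumed — Tate's
uniformisation and Tate's algorithm under unramified base change are the tree's proved `_holds`
theorems —, no `sorry`); this is ONE direction (`≤`) of KY Remark 1.4.2 / CGLS (eq:1) for the `f`-side,
the `≥`-direction (Pollack–Weston A.2 / Poitou–Tate) is not claimed and not needed by the v16 line;
BSD / Mazur's main conjecture / IMC2 is proved for no curve.

References: Greenberg–Vatsal 2000 §2 Prop. (2.4), Cor. (2.3); Keller–Yin Rem. 1.4.2, §1.5; CGLS 2022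
(eq:1), L893–901; Silverman *ATAEC* V.3.1, V.5.2–5.4, Ex. 5.11; *AEC* VII.5.1, VII.5.4, C.16.
-/

-- `Summit.BirchSwinnertonDyer.BirchSwinnertonDyer.…`: summit and sub-problem share a name (D-0017 layout).
set_option linter.dupNamespace false
set_option autoImplicit false

noncomputable section

open scoped Classical AddSubgroup

open CategoryTheory Function NumberField IsDedekindDomain Field ValuativeRel Polynomial
open Literature.NumberTheory.EllipticCurves Literature.NumberTheory.EllipticCurves.GreenbergSelmer
  Literature.NumberTheory.EllipticCurves.Castella2018 Literature.NumberTheory.QuadraticFields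
  Literature.NumberTheory.EllipticCurves.Rank1Residual
  Literature.NumberTheory.GaloisRepresentations Literature.NumberTheory.DiophantineGeometry
  Literature.NumberTheory.GaloisRepresentations.IsNonarchimedeanLocalField
  IsDedekindDomain.HeightOneSpectrum Rat.HeightOneSpectrum
  Summit.BirchSwinnertonDyer.Rank1Residual Summit.BirchSwinnertonDyer.Rank1Residual.X2
  Summit.BirchSwinnertonDyer.Rank1Residual.X2.NonPrimitiveQuotientCorank
  Summit.BirchSwinnertonDyer.BirchSwinnertonDyer.Theorems.SelmerAcQuotientCorankLeCurveLocalLambda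
open WeierstrassCurve (geomTorsion)
open Literature.NumberTheory.EllipticCurves.KellerYin2024 (curveLocalLambda)

namespace Summit.BirchSwinnertonDyer.BirchSwinnertonDyer.Theorems.FSideCorankLe

variable {K : Type} [Field K] [NumberField K]

/-- **The `f`-side `≤`-half, FINAL SUM, no side condition.**  For a globally minimal elliptic `E/ℚ`,
an odd prime `p ∤ N_E`, `K` imaginary quadratic with the Heegner hypothesis for `N_E`, an anticyclotomic
`ℤ_p`-extension `κ` with topological generator `γ`, any `𝔭` and `Sf` = the places of `K` above `N_E`:
`corank_{ℤ_p}(Sel_𝔭^{Sf}(E_K/K_∞) / Sel_𝔭(E_K/K_∞)) ≤ Σ_{w∈Sf} curveLocalLambda κ E_K w`.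
Proof: `zpCorank_selmerAc_quotient_le_sum_of_loc` (p612280) with `c_w = rootMultiplicity((Nw)⁻¹,
P̃_w(E_K))`; at `w ∈ Sf` the prime `ℓ = Nw` below `w` divides `N_E`, so `E` is bad at `ℓ`; additive at
`ℓ` ⇒ `E_K` additive at `w` (A233) ⇒ `0`; else `E_K` multiplicative at `w` and: split at `w` ⇒ p613424,
`P_w = 1 − X`; non-split at `w` ⇒ p617025 (unconditional, any residue characteristic), `P_w = 1 + X`.
[cite: GreenbergVatsal2000, §2 Prop. (2.4) pp. 22–23 and Cor. (2.3)]
[cite: KellerYin2024, Rem. 1.4.2 (surj for Self; arXiv:2402.12781v2 TeX L1130–1140) and §1.5 (L1337–1341)]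
[cite: CastellaGrossiLeeSkinner2022, (eq:1) (arXiv:2008.02571v2 TeX L882–884), L893–901 (𝒫_w(E))]
[cite: SilvermanATAEC1994, Ch. V Lemma 5.2 (c), Thm. 5.3 (a),(b), Cor. 5.4 (held copy PDF pp. 406–410)] -/
theorem zpCorank_selmerAc_quotient_le_sum_curveLocalLambda
    (W : WeierstrassCurve ℚ) [W.IsElliptic] [W.IsGloballyMinimal]
    {p : ℕ} [Fact p.Prime] (hp2 : 2 < p) (hpN : ¬ p ∣ W.conductorNorm ℤ)
    (hK : IsImaginaryQuadratic K) (hH : SatisfiesHeegnerHypothesis (W.conductorNorm ℤ) K)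
    (κ : ZpExtension K p) (hκ : κ.IsAnticyclotomic) {γ : absoluteGaloisGroup K}
    (hγ : κ.IsTopGenerator γ) (𝔭 : HeightOneSpectrum (𝓞 K)) (Sf : Finset (HeightOneSpectrum (𝓞 K)))
    (hSf : ∀ w : HeightOneSpectrum (𝓞 K), w ∈ Sf ↔ ((W.conductorNorm ℤ : ℤ) : 𝓞 K) ∈ w.asIdeal) :
    zpCorank (↥(AcSelmer.selmerAc (W.baseChange K) p κ 𝔭 (↑Sf : Set (HeightOneSpectrum (𝓞 K)))) ⧸
        (AcSelmer.selmerAc (W.baseChange K) p κ 𝔭 (∅ : Set (HeightOneSpectrum (𝓞 K)))).addSubgroupOf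
          (AcSelmer.selmerAc (W.baseChange K) p κ 𝔭 (↑Sf : Set (HeightOneSpectrum (𝓞 K))))) p ≤
      ∑ w ∈ Sf, KellerYin2024.curveLocalLambda κ (W.baseChange K) w := by
  haveI : (W.baseChange K).IsElliptic := by rw [WeierstrassCurve.baseChange]; infer_instance
  have hT : Silverman1994_thmV53_tateUniformisation.{0} :=
    TateCurve.Silverman1994_thmV53_tateUniformisation_holds
  have hp2' : p ≠ 2 := by omega
  have hp : p.Prime := Fact.out
  refine SelmerAcQuotientCorankOfLoc.zpCorank_selmerAc_quotient_le_sum_of_loc hK hp2 hH hpN κ hκ hγ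
    (W.baseChange K) 𝔭 Sf hSf
    (fun w ↦ (GreenbergVatsal2000.eulerFactorModP (W.baseChange K) p w).rootMultiplicity
      ((w.asIdeal.absNorm : ZMod p)⁻¹)) ?_
  intro w hw Y hY
  -- the place `w ∋ N_E`, the prime `ℓ = Nw` below it
  have hwN : ((W.conductorNorm ℤ : ℤ) : 𝓞 K) ∈ w.asIdeal := (hSf w).mp hw
  set u := w.under (𝓞 ℚ) with hu
  set ℓ := natGenerator u with hℓ
  have hℓprime : ℓ.Prime := prime_natGenerator u
  have hℓw : (ℓ : 𝓞 K) ∈ w.asIdeal := natCast_natGenerator_under_mem w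
  have hℓN : ℓ ∣ W.conductorNorm ℤ := natGenerator_under_dvd_of_mem w hwN
  have hℓp : ℓ ≠ p := fun h ↦ hpN (h ▸ hℓN)
  have hpw : ((p : ℕ) : 𝓞 K) ∉ w.asIdeal := by
    have hnd : ¬ (ℓ : ℤ) ∣ (p : ℤ) := by
      intro h
      have h' : ℓ ∣ p := by exact_mod_cast h
      exact hℓp ((Nat.prime_dvd_prime_iff_eq hℓprime hp).mp h')
    have h := intCast_notMem_of_not_dvd hℓprime hℓw hnd
    exact_mod_cast h
  have hbad : ¬ W.HasGoodReductionAt u := (W.dvd_conductorNorm_iff u).mp hℓN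
  by_cases hadd : W.HasAdditiveReductionAt u
  · -- additive at `ℓ`: `E_K` additive at `w`, the local group is finite
    have haddK : (W.baseChange K).HasAdditiveReductionAt w :=
      hasAdditiveReductionAt_baseChange_of_heegner W hK hH w hwN hadd
    rw [SelmerAcQuotientCorankOfLoc.zpCorank_eq_zero_of_hasAdditiveReductionAt (W.baseChange K)
      κ.kerSubgroup w hpw haddK (Iwasawa.inertia_le_kerSubgroup' κ w hpw) Y]
    exact Nat.zero_le _
  · -- multiplicative at `ℓ`, hence `E_K` multiplicative at `w`; split on `E_K`'s own type at `w`
    have hmultK : (W.baseChange K).HasMultiplicativeReductionAt w :=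
      hasMultiplicativeReductionAt_baseChange_of_heegner W hK hH w hwN hbad hadd
    have hD := UnrSelmerQuotientTorsionFiniteChar.exists_mem_decomp_apply_ne_one_of_heegner hK hp2 hH κ
      hκ w hwN hpw
    have hpos : 0 < KellerYin2024.numPlacesAbove κ w :=
      NumPlacesAboveRepresentatives.numPlacesAbove_pos κ w hD
    by_cases hsplitK : (W.baseChange K).HasSplitMultiplicativeReductionAt w
    · have hb := SelmerAcSplitMultiplicativePlace.zpCorank_le_of_hasSplitMultiplicativeReductionAt hT
        (W.baseChange K) hp2' κ hpw hsplitK Y hY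
      have hR := SelmerAcSplitMultiplicativePlace.curveLocalLambda_of_hasSplitMultiplicativeReductionAt
        (p := p) κ (W.baseChange K) hsplitK
      rw [KellerYin2024.curveLocalLambda_eq] at hR
      rw [Nat.eq_of_mul_eq_mul_left hpos hR]
      exact hb
    · have hb := SqrtGammaNonsplitFrobenius.zpCorank_le_of_not_hasSplitMultiplicativeReductionAt
        (W.baseChange K) hp2' κ hpw hmultK hsplitK Y hY
      have hR := SelmerAcMultiplicativePlaceSign.curveLocalLambda_of_not_hasSplitMultiplicativeReductionAt
        (p := p) κ (W.baseChange K) hmultK hsplitK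
      rw [KellerYin2024.curveLocalLambda_eq] at hR
      rw [Nat.eq_of_mul_eq_mul_left hpos hR]
      exact hb

/-- **`stub_fSideCorankLe` — the `f`-side `≤`-half AT THE BINDERS OF `rem142_goodLattice_selmerAc_imprimitive`
VERBATIM** (its `def` body with `=` replaced by `≤`; the extra binders `Red`, `Anom`, the rational-line
clause, (Heeg) for `p`, `E(K)[p] = 0`, `ι`, `v`, the two module hypotheses are carried unused; `Good W p`
= good reduction at `p` gives `p ∤ N_E` by `dvd_conductorNorm_iff_not_hasGoodReductionAtPrime`; the
topological generator comes as the instance binder `[Fact (κ.IsTopGenerator γ)]`).  The signature agreed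
with the LEAD successor under RULING L112 (2) (STATUS l.2590).
[cite: KellerYin2024, Rem. 1.4.2 (surj for Self; arXiv:2402.12781v2 TeX L1130–1140) and proof of Thm. 1.5.1 (L1358–1360)]
[cite: GreenbergVatsal2000, §2 Prop. (2.4)] -/
theorem stub_fSideCorankLe :
    ∀ (W : WeierstrassCurve ℚ) [W.IsElliptic] [W.IsGloballyMinimal] (p : ℕ) [Fact p.Prime],
    2 < p → Good W p → Red W p → Anom W p →
    (∀ Φ : AddSubgroup (geomTorsion W (p : ℤ)), IsRationalLine W p Φ → ¬ LineUnramifiedAt W p Φ) →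
    ∀ (K : Type) [Field K] [NumberField K], IsImaginaryQuadratic K →
      SatisfiesHeegnerHypothesis (W.conductorNorm ℤ) K → SatisfiesHeegnerHypothesis p K →
      (∀ Q : (W.baseChange K).toAffine.Point, p • Q = 0 → Q = 0) →
    ∀ (ι : K →+* ℚ_[p]) (v vbar : HeightOneSpectrum (𝓞 K)),
      (∀ x : 𝓞 K, x ∈ v.asIdeal ↔ ‖ι (x : K)‖ < 1) →
      ((p : ℕ) : 𝓞 K) ∈ vbar.asIdeal → vbar ≠ v →
    ∀ (κ : ZpExtension K p), κ.IsAnticyclotomic →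
    ∀ (γ : absoluteGaloisGroup K) [Fact (κ.IsTopGenerator γ)],
    ∀ (Sf : Finset (HeightOneSpectrum (𝓞 K))),
      (∀ w : HeightOneSpectrum (𝓞 K), w ∈ Sf ↔ ((W.conductorNorm ℤ : ℤ) : 𝓞 K) ∈ w.asIdeal) →
    Module.Finite (IwasawaAlgebra p) (AcSelmer.XAc (W.baseChange K) p κ vbar ∅ γ) →
    Module.IsTorsion (IwasawaAlgebra p) (AcSelmer.XAc (W.baseChange K) p κ vbar ∅ γ) →
    zpCorank (↥(AcSelmer.selmerAc (W.baseChange K) p κ vbar (↑Sf : Set (HeightOneSpectrum (𝓞 K)))) ⧸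
        (AcSelmer.selmerAc (W.baseChange K) p κ vbar (∅ : Set (HeightOneSpectrum (𝓞 K)))).addSubgroupOf
          (AcSelmer.selmerAc (W.baseChange K) p κ vbar (↑Sf : Set (HeightOneSpectrum (𝓞 K))))) p ≤
      ∑ w ∈ Sf, curveLocalLambda κ (W.baseChange K) w := by
  intro W _ _ p _ hp2 hgood _ _ _ K _ _ hK hH _ _ _ _ vbar _ _ _ κ hκ γ hγ Sf hSf _ _
  have hpN : ¬ p ∣ W.conductorNorm ℤ := fun h ↦
    (W.dvd_conductorNorm_iff_not_hasGoodReductionAtPrime p).mp h hgood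
  exact zpCorank_selmerAc_quotient_le_sum_curveLocalLambda W hp2 hpN hK hH κ hκ hγ.out vbar Sf hSf

end Summit.BirchSwinnertonDyer.BirchSwinnertonDyer.Theorems.FSideCorankLe

end
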